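import Mathlib.Analysis.Calculus.FDeriv.Comp
import Mathlib.Analysis.Calculus.FDeriv.Add
import Mathlib.Analysis.Calculus.FDeriv.Linear
import Mathlib.Analysis.Normed.Module.Basic
import Mathlib.Analysis.Complex.Basic
import Mathlib.Algebra.BigOperators.Intervals
import HarnessLib

/-!
# Route `UnitScaleTilt`, crux K1 «MinimiserStabilityRegPr» (stmt-QuantumFields-19200), route-R E′ (A′) P-A2 «JOINT-Σ», row F0″-a — **THE DUHAMEL TELESCOPE FOR A TOWER OF ONE-STEP MAPS**
# (lattice-free): the orbit `y_{m+1} = f_m(y_m)` minus its linear propagation `Lin_m y_0` (`Lin_{m+1} = T_m ∘ Lin_m`) obeys the EXACT recursion `d_{m+1} = (f_m y_m − T_m y_m) + T_m d_m`, hence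
# `y_k − Lin_k y_0 = Σ_{l<k} (T_{k−1}∘⋯∘T_{l+1})(f_l y_l − T_l y_l)`; with column-sum letters `Σ_c‖T_m v c‖ ≤ κ_m·Σ_c‖v c‖` the ℓ¹ size telescopes into DAMPED one-step defects
# `Σ_c‖(y_k − Lin_k y_0) c‖ ≤ Σ_{l<k} (Π_{l<l′<k} κ_{l′})·Σ_c‖(f_l y_l − T_l y_l) c‖`; and if every `f_m` vanishes and is differentiable at `0` with `Df_m(0) = T_m`, the composed map has
# `D(f_{k−1}∘⋯∘f_0)(0) = Lin_k`, so the chart remainder `F_k x − DF_k(0) x` IS that telescoped sum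

Cell `ym3-torus` (HUMAN RULING D-0037: YM₃ on the torus is ladder rung R3 — not d = 4, not a mass gap, not Clay), width seat `ym3-torus-px18` (gen 3); ★p1 g17 WORD 10 (4)∕WORD 11 (e)
«P-A2 F0″ → px18 g3»; ★routeR-w3 g6 LOCATE «P-A2 JOINT-Σ» (bc08ddff) §2 F0″ «`logChartTwS X − QTwS X = Σ_{l<k} T_{k−1}∘⋯∘T_{l+1}(f_l(y_l) − T_l y_l)` EXACTLY (discrete Duhamel for iterated maps;
`QTwS = T_{k−1}∘⋯∘T_0` by the chain rule at 0, `f_l(0) = 0`)».  `--supports stmt-QuantumFields-19200 --as helper`; Mathlib-only, def-free, 0 sorry; count-neutral.  THIS FILE is the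
lattice-free half (F0″-a); the EX-lane instantiation (F0″-b: `f_l` = the one-step covariant twisted average `dbarCovU (emlIterU l U₀♭)` in log coordinates, `logChartTwS` = the top of that
tower via ✓`dbarTwS_eq_dbarCovIterU_mul_inv`) is the sibling file.  Companion of ✓`ChartKernelTower` (p610533: the same towers, the KERNEL recursion (153); here the VALUE recursion (152)).

THE PRINT.  [Balaban1985Averaging] p. 40 (150)–(152): «Q_{j+1}(U₀, ηA) = Q(Ū₀ʲ, Q_j(U₀, ηA)) … C_{j+1}(U₀, A) = LQ(Ū₀ʲ)C_j(U₀, L^{−1}A) + C(Ū₀ʲ, L^{−1}Q_j(U₀)A + C_j(U₀, L^{−1}A)) (152)» — one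
step of exactly this recursion (`C_{j+1} = T_j C_j + (f_j − T_j)(y_j)` with `y_j = Lin_j y_0 + C_j`); p. 36 (127) the tower; [Balaban1985Variational] (44) p. 285 `C = Q(η·) − LʲηQ·` (the remainder
is «map minus linear part»).

WHAT IS PROVED (ns `…Theorems.IteratedMapTelescope`; levels indexed by `ι : ℕ → Type*` (finite), values in a normed ℂ-space `𝔸`, level-`m` space `ι m → 𝔸` — ✓`ChartKernelTower`'s letters).
* §1 `rec_bound_sum_prod` — scalar: `δ₀ ≤ 0`, `δ_{m+1} ≤ ρ_m + κ_m δ_m`, `κ ≥ 0` ⇒ `δ_k ≤ Σ_{l<k} (Π_{l′ ∈ Ico (l+1) k} κ_{l′})·ρ_l`; `rec_bound_sum_pow` (constant `κ`: `Σ_{l<k} κ^{k−1−l}·ρ_l`, the shape of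
  ✓`Prop7JointRowOfLevelMasses.jointRow_of_levelMasses`).
* §2 ★ `orbit_sub_lin_zero`∕`orbit_sub_lin_succ` — THE EXACT ONE-STEP TELESCOPE `y_{m+1} − Lin_{m+1}y_0 = (f_m y_m − T_m y_m) + T_m (y_m − Lin_m y_0)`;
  ★ `orbit_sub_lin_eq_sum` — the closed form with propagators `P l m` (`P l (l+1) = id`, `P l (m+1) = T_m ∘ P l m`): `y_m − Lin_m y_0 = Σ_{l<m} P l m (f_l y_l − T_l y_l)`.
* §3 ★★ `l1_orbit_sub_lin_le` — with `Σ_c‖T_m v c‖ ≤ κ_m·Σ_c‖v c‖` (`κ_m ≥ 0`): `Σ_c‖(y_k − Lin_k y_0) c‖ ≤ Σ_{l<k}(Π_{Ico (l+1) k} κ)·Σ_c‖(f_l y_l − T_l y_l) c‖`; `l1_orbit_sub_lin_le_pow` (constant `κ`).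
* §4 ★★ `hasFDerivAt_iterate_zero` — `f_m 0 = 0`, `HasFDerivAt (f_m) (T_m) 0` (`m < k`), `F_0 = id`, `F_{m+1} = f_m ∘ F_m` ⇒ `F_m 0 = 0` and `HasFDerivAt (F_k) (Lin_k) 0`; `fderiv_iterate_zero`.
* §5 ★★★ `iterate_sub_fderiv_zero_eq_sum` — THE F0″ ROW ABSTRACTLY: `F_k x − (fderiv ℂ (F_k) 0) x = Σ_{l<k} P l k (f_l (F_l x) − T_l (F_l x))`, and ★★★ `l1_iterate_sub_fderiv_zero_le_pow` — its ℓ¹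
  damped form `Σ_c‖(F_k x − fderiv (F_k) 0 x) c‖ ≤ Σ_{l<k} κ^{k−1−l}·Σ_c‖(f_l (F_l x) − T_l (F_l x)) c‖`.
HONEST SCOPE.  Algebra + the chain rule at a fixed point; no lattice object, no estimate of any one-step defect (F1″), no column-sum letter proved (F2″), no level-mass law (F3″).  Nothing of P-A2,
hcoW, E′, EX, the crux, d = 4 or the mass gap is claimed.

References: T. Bałaban, CMP **98** (1985) 17–51 [Balaban1985Averaging] ((127) p.36, (150)–(153) pp.40–41); CMP **102** (1985) 277–309 [Balaban1985Variational] ((44) p.285).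
-/

set_option autoImplicit false

noncomputable section

open scoped BigOperators

namespace Summit.QuantumFields.YangMills.Theorems.IteratedMapTelescope

/-! ## §1 The scalar damping lemma -/

section Scalar

/-- **DAMPED ACCUMULATION**: `δ₀ ≤ 0`, `δ_{m+1} ≤ ρ_m + κ_m·δ_m` with `κ_m ≥ 0` give `δ_k ≤ Σ_{l<k} (Π_{l′∈[l+1,k)} κ_{l′})·ρ_l`. [folklore] -/
theorem rec_bound_sum_prod (δ ρ κ : ℕ → ℝ) (hκ : ∀ m, 0 ≤ κ m) (h0 : δ 0 ≤ 0) (hrec : ∀ m, δ (m + 1) ≤ ρ m + κ m * δ m) :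
    ∀ k, δ k ≤ ∑ l ∈ Finset.range k, (∏ l' ∈ Finset.Ico (l + 1) k, κ l') * ρ l := by
  intro k
  induction k with
  | zero => simpa using h0
  | succ k ih =>
    calc δ (k + 1) ≤ ρ k + κ k * δ k := hrec k
      _ ≤ ρ k + κ k * ∑ l ∈ Finset.range k, (∏ l' ∈ Finset.Ico (l + 1) k, κ l') * ρ l := by
          have := mul_le_mul_of_nonneg_left ih (hκ k); linarith
      _ = ∑ l ∈ Finset.range (k + 1), (∏ l' ∈ Finset.Ico (l + 1) (k + 1), κ l') * ρ l := by
          rw [Finset.sum_range_succ, Finset.Ico_self, Finset.prod_empty, one_mul, Finset.mul_sum, add_comm]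
          congr 1
          refine Finset.sum_congr rfl fun l hl => ?_
          have hlk : l + 1 ≤ k := Finset.mem_range.1 hl
          rw [Finset.prod_Ico_succ_top hlk, ← mul_assoc, mul_comm (κ k)]

/-- Constant damping: `δ_k ≤ Σ_{l<k} κ^{k−1−l}·ρ_l` (the shape of ✓`Prop7JointRowOfLevelMasses.jointRow_of_levelMasses`'s left side). [folklore] -/
theorem rec_bound_sum_pow (δ ρ : ℕ → ℝ) {κ : ℝ} (hκ : 0 ≤ κ) (h0 : δ 0 ≤ 0) (hrec : ∀ m, δ (m + 1) ≤ ρ m + κ * δ m) :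
    ∀ k, δ k ≤ ∑ l ∈ Finset.range k, κ ^ (k - 1 - l) * ρ l := by
  intro k
  have h := rec_bound_sum_prod δ ρ (fun _ => κ) (fun _ => hκ) h0 hrec k
  refine h.trans (le_of_eq (Finset.sum_congr rfl fun l hl => ?_))
  rw [Finset.prod_const, Nat.card_Ico]
  congr 2
  omega

end Scalar

/-! ## §2 The exact telescope along the orbit -/

section Orbit

variable {𝔸 : Type*} [NormedAddCommGroup 𝔸] [NormedSpace ℂ 𝔸] (ι : ℕ → Type*)
  (f : (m : ℕ) → (ι m → 𝔸) → (ι (m + 1) → 𝔸)) (T : (m : ℕ) → (ι m → 𝔸) →L[ℂ] (ι (m + 1) → 𝔸))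
  (Lin : (m : ℕ) → (ι 0 → 𝔸) →L[ℂ] (ι m → 𝔸)) (hLin0 : Lin 0 = ContinuousLinearMap.id ℂ (ι 0 → 𝔸)) (hLins : ∀ m, Lin (m + 1) = (T m).comp (Lin m))
  (y : (m : ℕ) → ι m → 𝔸) (hys : ∀ m, y (m + 1) = f m (y m))

include hLin0 in
/-- At level `0` the orbit IS its linear propagation: `y_0 − Lin_0 y_0 = 0`. [cite: Balaban1985Averaging, (150) p.40] -/
theorem orbit_sub_lin_zero : y 0 - Lin 0 (y 0) = 0 := by
  rw [hLin0, ContinuousLinearMap.id_apply, sub_self]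

include hLins hys in
/-- ★ **THE EXACT ONE-STEP TELESCOPE** ((152) with `C_m := y_m − Lin_m y_0`): `y_{m+1} − Lin_{m+1} y_0 = (f_m y_m − T_m y_m) + T_m (y_m − Lin_m y_0)`. [cite: Balaban1985Averaging, (152) p.40] -/
theorem orbit_sub_lin_succ (m : ℕ) : y (m + 1) - Lin (m + 1) (y 0) = (f m (y m) - T m (y m)) + T m (y m - Lin m (y 0)) := by
  rw [hys m, hLins m, ContinuousLinearMap.comp_apply, map_sub]
  abel

include hLin0 hLins hys in
/-- ★ **THE CLOSED FORM (DISCRETE DUHAMEL)**: with propagators `P l m : (ι (l+1) → 𝔸) →L (ι m → 𝔸)`, `P l (l+1) = id`, `P l (m+1) = T_m ∘ P l m` (`l + 1 ≤ m`),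
`y_m − Lin_m y_0 = Σ_{l<m} P l m (f_l y_l − T_l y_l)`. [cite: Balaban1985Averaging, (150)–(152) p.40] -/
theorem orbit_sub_lin_eq_sum (P : (l m : ℕ) → (ι (l + 1) → 𝔸) →L[ℂ] (ι m → 𝔸))
    (hPdiag : ∀ l, P l (l + 1) = ContinuousLinearMap.id ℂ (ι (l + 1) → 𝔸)) (hPsucc : ∀ l m, l + 1 ≤ m → P l (m + 1) = (T m).comp (P l m)) :
    ∀ m, y m - Lin m (y 0) = ∑ l ∈ Finset.range m, P l m (f l (y l) - T l (y l)) := by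
  intro m
  induction m with
  | zero => rw [orbit_sub_lin_zero ι Lin hLin0 y, Finset.range_zero, Finset.sum_empty]
  | succ m ih =>
    rw [orbit_sub_lin_succ ι f T Lin hLins y hys m, ih, map_sum, Finset.sum_range_succ]
    have h1 : P m (m + 1) (f m (y m) - T m (y m)) = f m (y m) - T m (y m) := by
      rw [hPdiag m]; rfl
    have h2 : ∀ l ∈ Finset.range m, T m (P l m (f l (y l) - T l (y l))) = P l (m + 1) (f l (y l) - T l (y l)) := by
      intro l hl
      rw [hPsucc l m (by have := Finset.mem_range.1 hl; omega), ContinuousLinearMap.comp_apply]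
    rw [h1, Finset.sum_congr rfl h2]
    exact add_comm _ _

end Orbit

/-! ## §3 The ℓ¹ telescope with column-sum letters -/

section L1

variable {𝔸 : Type*} [NormedAddCommGroup 𝔸] [NormedSpace ℂ 𝔸] (ι : ℕ → Type*) [∀ m, Fintype (ι m)]
  (f : (m : ℕ) → (ι m → 𝔸) → (ι (m + 1) → 𝔸)) (T : (m : ℕ) → (ι m → 𝔸) →L[ℂ] (ι (m + 1) → 𝔸))
  (Lin : (m : ℕ) → (ι 0 → 𝔸) →L[ℂ] (ι m → 𝔸)) (hLin0 : Lin 0 = ContinuousLinearMap.id ℂ (ι 0 → 𝔸)) (hLins : ∀ m, Lin (m + 1) = (T m).comp (Lin m))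
  (y : (m : ℕ) → ι m → 𝔸) (hys : ∀ m, y (m + 1) = f m (y m))
  (κ : ℕ → ℝ) (hκ : ∀ m, 0 ≤ κ m) (hT : ∀ (m : ℕ) (v : ι m → 𝔸), ∑ c, ‖T m v c‖ ≤ κ m * ∑ c', ‖v c'‖)

include hLin0 hLins hys hκ hT in
/-- ★★ **THE ℓ¹ TELESCOPE WITH DAMPING**: if every one-step linear part has column sums `Σ_c‖T_m v c‖ ≤ κ_m·Σ_c‖v c‖` (the F2″ letter), then
`Σ_c ‖(y_k − Lin_k y_0) c‖ ≤ Σ_{l<k} (Π_{l′∈[l+1,k)} κ_{l′})·Σ_c ‖(f_l y_l − T_l y_l) c‖`. [cite: Balaban1985Averaging, (150)–(152) p.40] -/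
theorem l1_orbit_sub_lin_le (k : ℕ) :
    ∑ c, ‖(y k - Lin k (y 0)) c‖ ≤ ∑ l ∈ Finset.range k, (∏ l' ∈ Finset.Ico (l + 1) k, κ l') * ∑ c', ‖(f l (y l) - T l (y l)) c'‖ := by
  refine rec_bound_sum_prod (fun m => ∑ c, ‖(y m - Lin m (y 0)) c‖) (fun m => ∑ c', ‖(f m (y m) - T m (y m)) c'‖) κ hκ ?_ ?_ k
  · rw [orbit_sub_lin_zero ι Lin hLin0 y]; simp
  · intro m
    rw [orbit_sub_lin_succ ι f T Lin hLins y hys m]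
    calc ∑ c, ‖((f m (y m) - T m (y m)) + T m (y m - Lin m (y 0))) c‖
        ≤ ∑ c, (‖(f m (y m) - T m (y m)) c‖ + ‖T m (y m - Lin m (y 0)) c‖) := Finset.sum_le_sum fun c _ => norm_add_le _ _
      _ = ∑ c, ‖(f m (y m) - T m (y m)) c‖ + ∑ c, ‖T m (y m - Lin m (y 0)) c‖ := Finset.sum_add_distrib
      _ ≤ ∑ c, ‖(f m (y m) - T m (y m)) c‖ + κ m * ∑ c', ‖(y m - Lin m (y 0)) c'‖ := by
          have := hT m (y m - Lin m (y 0)); linarith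

include hLin0 hLins hys in
/-- Constant damping `κ` (F2″ at d = 3: `κ = (L²)⁻¹·(1 + c·e)`-class): `Σ_c ‖(y_k − Lin_k y_0) c‖ ≤ Σ_{l<k} κ^{k−1−l}·Σ_c ‖(f_l y_l − T_l y_l) c‖`. [cite: Balaban1985Averaging, (150)–(152) p.40] -/
theorem l1_orbit_sub_lin_le_pow {κ₀ : ℝ} (hκ₀ : 0 ≤ κ₀) (hT₀ : ∀ (m : ℕ) (v : ι m → 𝔸), ∑ c, ‖T m v c‖ ≤ κ₀ * ∑ c', ‖v c'‖) (k : ℕ) :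
    ∑ c, ‖(y k - Lin k (y 0)) c‖ ≤ ∑ l ∈ Finset.range k, κ₀ ^ (k - 1 - l) * ∑ c', ‖(f l (y l) - T l (y l)) c'‖ := by
  have h := l1_orbit_sub_lin_le ι f T Lin hLin0 hLins y hys (fun _ => κ₀) (fun _ => hκ₀) hT₀ k
  refine h.trans (le_of_eq (Finset.sum_congr rfl fun l hl => ?_))
  rw [Finset.prod_const, Nat.card_Ico]
  congr 2
  omega

end L1

/-! ## §4 The derivative of the composed map at the fixed point `0` -/

section Deriv

variable {𝔸 : Type*} [NormedAddCommGroup 𝔸] [NormedSpace ℂ 𝔸] (ι : ℕ → Type*) [∀ m, Fintype (ι m)]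
  (f : (m : ℕ) → (ι m → 𝔸) → (ι (m + 1) → 𝔸)) (T : (m : ℕ) → (ι m → 𝔸) →L[ℂ] (ι (m + 1) → 𝔸))
  (Lin : (m : ℕ) → (ι 0 → 𝔸) →L[ℂ] (ι m → 𝔸)) (hLin0 : Lin 0 = ContinuousLinearMap.id ℂ (ι 0 → 𝔸)) (hLins : ∀ m, Lin (m + 1) = (T m).comp (Lin m))
  (F : (m : ℕ) → (ι 0 → 𝔸) → (ι m → 𝔸)) (hF0 : ∀ x, F 0 x = x) (hFs : ∀ m x, F (m + 1) x = f m (F m x))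
  (hf0 : ∀ m, f m 0 = 0)

omit [NormedSpace ℂ 𝔸] [∀ m, Fintype (ι m)] in
include hF0 hFs hf0 in
/-- `0` is a fixed point of every level of the tower: `F_m 0 = 0`. [cite: Balaban1985Averaging, (127) p.36] -/
theorem iterate_zero : ∀ m, F m 0 = 0 := by
  intro m
  induction m with
  | zero => exact hF0 0
  | succ m ih => rw [hFs, ih, hf0]

include hLin0 hLins hF0 hFs hf0 in
/-- ★★ **THE LINEAR PART OF THE COMPOSED MAP AT `0` IS THE COMPOSED LINEAR PART**: `HasFDerivAt f_m T_m 0` for `m < k` ⇒ `HasFDerivAt F_k Lin_k 0` (chain rule at the orbit of the fixed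
point `0`; print: «Q_k(U₀) = Q(Ū₀^{k−1})⋯Q(U₀)» is the linear part of `Q_k(U₀, ·)`). [cite: Balaban1985Averaging, (127) p.36, (141) p.39] -/
theorem hasFDerivAt_iterate_zero (k : ℕ) (hf : ∀ m, m < k → HasFDerivAt (f m) (T m) 0) : HasFDerivAt (F k) (Lin k) 0 := by
  induction k with
  | zero =>
    have hF : F 0 = id := funext hF0
    rw [hF, hLin0]
    exact hasFDerivAt_id (𝕜 := ℂ) (0 : ι 0 → 𝔸)
  | succ k ih =>
    have hF : F (k + 1) = f k ∘ F k := funext fun x => hFs k x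
    rw [hF, hLins k]
    have hk := hf k (Nat.lt_succ_self k)
    rw [← iterate_zero ι f F hF0 hFs hf0 k] at hk
    exact hk.comp 0 (ih fun m hm => hf m (hm.trans (Nat.lt_succ_self k)))

include hLin0 hLins hF0 hFs hf0 in
/-- `fderiv ℂ (F_k) 0 = Lin_k`. [cite: Balaban1985Averaging, (127) p.36, (141) p.39] -/
theorem fderiv_iterate_zero (k : ℕ) (hf : ∀ m, m < k → HasFDerivAt (f m) (T m) 0) : fderiv ℂ (F k) 0 = Lin k :=
  (hasFDerivAt_iterate_zero ι f T Lin hLin0 hLins F hF0 hFs hf0 k hf).fderiv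

end Deriv

/-! ## §5 ★★★ The chart remainder of the composed map is the telescoped sum of damped one-step defects -/

section Telescope

variable {𝔸 : Type*} [NormedAddCommGroup 𝔸] [NormedSpace ℂ 𝔸] (ι : ℕ → Type*) [∀ m, Fintype (ι m)]
  (f : (m : ℕ) → (ι m → 𝔸) → (ι (m + 1) → 𝔸)) (T : (m : ℕ) → (ι m → 𝔸) →L[ℂ] (ι (m + 1) → 𝔸))
  (Lin : (m : ℕ) → (ι 0 → 𝔸) →L[ℂ] (ι m → 𝔸)) (hLin0 : Lin 0 = ContinuousLinearMap.id ℂ (ι 0 → 𝔸)) (hLins : ∀ m, Lin (m + 1) = (T m).comp (Lin m))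
  (F : (m : ℕ) → (ι 0 → 𝔸) → (ι m → 𝔸)) (hF0 : ∀ x, F 0 x = x) (hFs : ∀ m x, F (m + 1) x = f m (F m x))
  (hf0 : ∀ m, f m 0 = 0)

include hLin0 hLins hF0 hFs hf0 in
/-- ★★★ **F0″, ABSTRACT FORM**: for a tower with `f_m 0 = 0`, `Df_m(0) = T_m` (`m < k`), and propagators `P l m` (`P l (l+1) = id`, `P l (m+1) = T_m ∘ P l m`):
`F_k x − (fderiv ℂ F_k 0) x = Σ_{l<k} P l k (f_l (F_l x) − T_l (F_l x))` — the chart remainder «map minus its linear part at 0» ((44)) of the COMPOSED average is the Duhamel sum of the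
one-step remainders along the orbit, transported by the composed linear parts. [cite: Balaban1985Averaging, (150)–(152) p.40; Balaban1985Variational, (44) p.285] -/
theorem iterate_sub_fderiv_zero_eq_sum (k : ℕ) (hf : ∀ m, m < k → HasFDerivAt (f m) (T m) 0)
    (P : (l m : ℕ) → (ι (l + 1) → 𝔸) →L[ℂ] (ι m → 𝔸))
    (hPdiag : ∀ l, P l (l + 1) = ContinuousLinearMap.id ℂ (ι (l + 1) → 𝔸)) (hPsucc : ∀ l m, l + 1 ≤ m → P l (m + 1) = (T m).comp (P l m)) (x : ι 0 → 𝔸) :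
    F k x - fderiv ℂ (F k) 0 x = ∑ l ∈ Finset.range k, P l k (f l (F l x) - T l (F l x)) := by
  rw [fderiv_iterate_zero ι f T Lin hLin0 hLins F hF0 hFs hf0 k hf]
  have h := orbit_sub_lin_eq_sum ι f T Lin hLin0 hLins (fun m => F m x) (fun m => hFs m x) P hPdiag hPsucc k
  rwa [hF0] at h

include hLin0 hLins hF0 hFs hf0 in
/-- ★★★ **F0″, ℓ¹ DAMPED FORM** (what F2″∕F4″ of P-A2 consume): with constant column-sum letter `Σ_c‖T_m v c‖ ≤ κ·Σ_c‖v c‖`,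
`Σ_c ‖(F_k x − fderiv F_k 0 x) c‖ ≤ Σ_{l<k} κ^{k−1−l}·Σ_c ‖(f_l (F_l x) − T_l (F_l x)) c‖`. [cite: Balaban1985Averaging, (150)–(152) p.40; Balaban1985Variational, (44) p.285] -/
theorem l1_iterate_sub_fderiv_zero_le_pow (k : ℕ) (hf : ∀ m, m < k → HasFDerivAt (f m) (T m) 0)
    {κ : ℝ} (hκ : 0 ≤ κ) (hT : ∀ (m : ℕ) (v : ι m → 𝔸), ∑ c, ‖T m v c‖ ≤ κ * ∑ c', ‖v c'‖) (x : ι 0 → 𝔸) :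
    ∑ c, ‖(F k x - fderiv ℂ (F k) 0 x) c‖ ≤ ∑ l ∈ Finset.range k, κ ^ (k - 1 - l) * ∑ c', ‖(f l (F l x) - T l (F l x)) c'‖ := by
  rw [fderiv_iterate_zero ι f T Lin hLin0 hLins F hF0 hFs hf0 k hf]
  have h := l1_orbit_sub_lin_le_pow ι f T Lin hLin0 hLins (fun m => F m x) (fun m => hFs m x) hκ hT k
  rwa [hF0] at h

include hLin0 hLins hF0 hFs hf0 in
/-- The same with level-dependent letters `κ_m` (F2″'s `(L²)⁻¹·(1 + c·e_m)`). [cite: Balaban1985Averaging, (150)–(152) p.40] -/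
theorem l1_iterate_sub_fderiv_zero_le_prod (k : ℕ) (hf : ∀ m, m < k → HasFDerivAt (f m) (T m) 0)
    (κ : ℕ → ℝ) (hκ : ∀ m, 0 ≤ κ m) (hT : ∀ (m : ℕ) (v : ι m → 𝔸), ∑ c, ‖T m v c‖ ≤ κ m * ∑ c', ‖v c'‖) (x : ι 0 → 𝔸) :
    ∑ c, ‖(F k x - fderiv ℂ (F k) 0 x) c‖ ≤ ∑ l ∈ Finset.range k, (∏ l' ∈ Finset.Ico (l + 1) k, κ l') * ∑ c', ‖(f l (F l x) - T l (F l x)) c'‖ := by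
  rw [fderiv_iterate_zero ι f T Lin hLin0 hLins F hF0 hFs hf0 k hf]
  have h := l1_orbit_sub_lin_le ι f T Lin hLin0 hLins (fun m => F m x) (fun m => hFs m x) κ hκ hT k
  rwa [hF0] at h

end Telescope

/-! ## §6 (v1.1) The same with every letter quantified BELOW THE TOP LEVEL only (`m < k`) — so a lattice knit whose one-step objects are meaningful only for `m < k` can stop at the top
(★routeR-w3 g7's second-read remark 2026-08-29T02:20:10Z); previous declarations unchanged -/

section OfLt

/-- **DAMPED ACCUMULATION, letters below the top**: `δ₀ ≤ 0`, `δ_{m+1} ≤ ρ_m + κ_m·δ_m` and `κ_m ≥ 0` for `m < k` give `δ_k ≤ Σ_{l<k} (Π_{l′∈[l+1,k)} κ_{l′})·ρ_l`. [folklore] -/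
theorem rec_bound_sum_prod_of_lt (δ ρ κ : ℕ → ℝ) (k : ℕ) (hκ : ∀ m, m < k → 0 ≤ κ m) (h0 : δ 0 ≤ 0)
    (hrec : ∀ m, m < k → δ (m + 1) ≤ ρ m + κ m * δ m) :
    δ k ≤ ∑ l ∈ Finset.range k, (∏ l' ∈ Finset.Ico (l + 1) k, κ l') * ρ l := by
  suffices hj : ∀ j, j ≤ k → δ j ≤ ∑ l ∈ Finset.range j, (∏ l' ∈ Finset.Ico (l + 1) j, κ l') * ρ l from hj k le_rfl
  intro j
  induction j with
  | zero => intro _; simpa using h0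
  | succ j ih =>
    intro hjk
    have hj : j < k := Nat.lt_of_succ_le hjk
    calc δ (j + 1) ≤ ρ j + κ j * δ j := hrec j hj
      _ ≤ ρ j + κ j * ∑ l ∈ Finset.range j, (∏ l' ∈ Finset.Ico (l + 1) j, κ l') * ρ l := by
          have := mul_le_mul_of_nonneg_left (ih hj.le) (hκ j hj); linarith
      _ = ∑ l ∈ Finset.range (j + 1), (∏ l' ∈ Finset.Ico (l + 1) (j + 1), κ l') * ρ l := by
          rw [Finset.sum_range_succ, Finset.Ico_self, Finset.prod_empty, one_mul, Finset.mul_sum, add_comm]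
          congr 1
          refine Finset.sum_congr rfl fun l hl => ?_
          have hlk : l + 1 ≤ j := Finset.mem_range.1 hl
          rw [Finset.prod_Ico_succ_top hlk, ← mul_assoc, mul_comm (κ j)]

variable {𝔸 : Type*} [NormedAddCommGroup 𝔸] [NormedSpace ℂ 𝔸] (ι : ℕ → Type*) [∀ m, Fintype (ι m)]
  (f : (m : ℕ) → (ι m → 𝔸) → (ι (m + 1) → 𝔸)) (T : (m : ℕ) → (ι m → 𝔸) →L[ℂ] (ι (m + 1) → 𝔸))
  (Lin : (m : ℕ) → (ι 0 → 𝔸) →L[ℂ] (ι m → 𝔸)) (hLin0 : Lin 0 = ContinuousLinearMap.id ℂ (ι 0 → 𝔸)) (hLins : ∀ m, Lin (m + 1) = (T m).comp (Lin m))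

include hLin0 hLins in
/-- ★★ **THE ℓ¹ TELESCOPE WITH DAMPING, column-sum letters for `m < k` only**: `Σ_c ‖(y_k − Lin_k y_0) c‖ ≤ Σ_{l<k} (Π_{l′∈[l+1,k)} κ_{l′})·Σ_c ‖(f_l y_l − T_l y_l) c‖`.
[cite: Balaban1985Averaging, (150)–(152) p.40] -/
theorem l1_orbit_sub_lin_le_of_lt (y : (m : ℕ) → ι m → 𝔸) (hys : ∀ m, y (m + 1) = f m (y m)) (k : ℕ)
    (κ : ℕ → ℝ) (hκ : ∀ m, m < k → 0 ≤ κ m) (hT : ∀ m, m < k → ∀ v : ι m → 𝔸, ∑ c, ‖T m v c‖ ≤ κ m * ∑ c', ‖v c'‖) :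
    ∑ c, ‖(y k - Lin k (y 0)) c‖ ≤ ∑ l ∈ Finset.range k, (∏ l' ∈ Finset.Ico (l + 1) k, κ l') * ∑ c', ‖(f l (y l) - T l (y l)) c'‖ := by
  refine rec_bound_sum_prod_of_lt (fun m => ∑ c, ‖(y m - Lin m (y 0)) c‖) (fun m => ∑ c', ‖(f m (y m) - T m (y m)) c'‖) κ k hκ ?_ ?_
  · rw [orbit_sub_lin_zero ι Lin hLin0 y]; simp
  · intro m hm
    rw [orbit_sub_lin_succ ι f T Lin hLins y hys m]
    calc ∑ c, ‖((f m (y m) - T m (y m)) + T m (y m - Lin m (y 0))) c‖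
        ≤ ∑ c, (‖(f m (y m) - T m (y m)) c‖ + ‖T m (y m - Lin m (y 0)) c‖) := Finset.sum_le_sum fun c _ => norm_add_le _ _
      _ = ∑ c, ‖(f m (y m) - T m (y m)) c‖ + ∑ c, ‖T m (y m - Lin m (y 0)) c‖ := Finset.sum_add_distrib
      _ ≤ ∑ c, ‖(f m (y m) - T m (y m)) c‖ + κ m * ∑ c', ‖(y m - Lin m (y 0)) c'‖ := by
          have := hT m hm (y m - Lin m (y 0)); linarith

include hLin0 hLins in
/-- Constant damping, letters for `m < k` only: `Σ_c ‖(y_k − Lin_k y_0) c‖ ≤ Σ_{l<k} κ^{k−1−l}·Σ_c ‖(f_l y_l − T_l y_l) c‖`. [cite: Balaban1985Averaging, (150)–(152) p.40] -/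
theorem l1_orbit_sub_lin_le_pow_of_lt (y : (m : ℕ) → ι m → 𝔸) (hys : ∀ m, y (m + 1) = f m (y m)) (k : ℕ)
    {κ₀ : ℝ} (hκ₀ : 0 ≤ κ₀) (hT₀ : ∀ m, m < k → ∀ v : ι m → 𝔸, ∑ c, ‖T m v c‖ ≤ κ₀ * ∑ c', ‖v c'‖) :
    ∑ c, ‖(y k - Lin k (y 0)) c‖ ≤ ∑ l ∈ Finset.range k, κ₀ ^ (k - 1 - l) * ∑ c', ‖(f l (y l) - T l (y l)) c'‖ := by
  have h := l1_orbit_sub_lin_le_of_lt ι f T Lin hLin0 hLins y hys k (fun _ => κ₀) (fun _ _ => hκ₀) hT₀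
  refine h.trans (le_of_eq (Finset.sum_congr rfl fun l hl => ?_))
  rw [Finset.prod_const, Nat.card_Ico]
  congr 2
  omega

variable (F : (m : ℕ) → (ι 0 → 𝔸) → (ι m → 𝔸)) (hF0 : ∀ x, F 0 x = x) (hFs : ∀ m x, F (m + 1) x = f m (F m x)) (hf0 : ∀ m, f m 0 = 0)

include hLin0 hLins hF0 hFs hf0 in
/-- ★★★ **F0″, ℓ¹ DAMPED FORM, letters for `m < k` only**: `Σ_c ‖(F_k x − fderiv F_k 0 x) c‖ ≤ Σ_{l<k} κ^{k−1−l}·Σ_c ‖(f_l (F_l x) − T_l (F_l x)) c‖`.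
[cite: Balaban1985Averaging, (150)–(152) p.40; Balaban1985Variational, (44) p.285] -/
theorem l1_iterate_sub_fderiv_zero_le_pow_of_lt (k : ℕ) (hf : ∀ m, m < k → HasFDerivAt (f m) (T m) 0)
    {κ : ℝ} (hκ : 0 ≤ κ) (hT : ∀ m, m < k → ∀ v : ι m → 𝔸, ∑ c, ‖T m v c‖ ≤ κ * ∑ c', ‖v c'‖) (x : ι 0 → 𝔸) :
    ∑ c, ‖(F k x - fderiv ℂ (F k) 0 x) c‖ ≤ ∑ l ∈ Finset.range k, κ ^ (k - 1 - l) * ∑ c', ‖(f l (F l x) - T l (F l x)) c'‖ := by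
  rw [fderiv_iterate_zero ι f T Lin hLin0 hLins F hF0 hFs hf0 k hf]
  have h := l1_orbit_sub_lin_le_pow_of_lt ι f T Lin hLin0 hLins (fun m => F m x) (fun m => hFs m x) k hκ hT
  rwa [hF0] at h

end OfLt

end Summit.QuantumFields.YangMills.Theorems.IteratedMapTelescope

end
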